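import Summits.QuantumFields.YangMills.Theorems.UnitScaleTiltProp7SymAvgTwSymDefs
import Summits.QuantumFields.YangMills.Theorems.UnitScaleTiltProp7SymAvgTwBridge
import HarnessLib

/-!
# Route `UnitScaleTilt`, crux K1 child «MinimiserStabilityRegPr» (stmt-QuantumFields-19200), stub EX, route (α) — (3c) SYM-FRAME TWIN of ✓p607140 `…Prop7SymAvgTwBridge`
# (OWNER RULING g26-№12 (2) «NEED A SYM-FRAME TWIN … (3c) ✓p607140 bridge»): **THE BRIDGE `QTwS = QSym − D_{Ū₀} ∘ r_sym`** between the re-based twisted chart of record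
# (✓`Prop7SymAvgTwSym.logChartTwS`, symmetric centre-anchored covariant frames `frameTwS`) and the computational core `Prop7SymAvgGL.logChartSym`, in DERIVATIVE FORM, with the two
# differentiability inputs displayed by name exactly as in p607140: `hG : HasFDerivAt (A ↦ D̄(e^{A}U₀)·D̄(U₀)⁻¹) G′ 0` (✓`Prop7SymAvgRelDiffT3.hasFDerivAt_rel_of_regPr`) and
# `hr : ∀ y, HasFDerivAt (A ↦ frameTwS U₀ A y) (r y) 0` (brick W4 `…SymFrameBound` of the EX plan — NOT here).

Cell `ym3-torus` ∕ width seat `ym-ust-20520-w5` (gen 3).  YM₃ on T³ is ladder rung R3, not the Clay problem; nothing here is a claim about the stub, the crux or the gap.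

WHAT IS PROVED — the text of ✓p607140 VERBATIM with `frameTwS`∕`dbarTwS`∕`logChartTwS`∕`QTwS` for `frameTw`∕`dbarTw`∕`logChartTw`∕`QTw` (the (T) formulas are frame-abstract, so the
proofs transfer line by line; the frame-free lemmas `logChartSym_apply_rel`, `rel_zero`, `covDeriv_pi_apply`, `QSym_eq_of_hasFDerivAt` are IMPORTED from ✓p607140, not restated): §1 `dbarTwS_eq_conj`,
`logChartTwS_apply_conj`; §2 ★★★`hasFDerivAt_logChartTwS` — `HasFDerivAt (logChartTwS U₀) (G′ − D_{Ū₀}∘r) 0`, ★★★`QTwS_eq_QSym_sub` — `QTwS U₀ = QSym U₀ − D_{Ū₀}∘r`, `QTwS_apply_eq`.  At `U₀ = 1` with `r = d(frameTwS)₀`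
this is consistent with (J2) (`QTwS 1 = tube`): there `QSym 1 = tube + δ(S_sym)`-type legs and `D∘r_sym` removes exactly them (not typed here).
HONEST FRAMING.  Pure calculus over the defs of `…Prop7SymAvgTwSymDefs`; no estimate; nothing of print is asserted.  `--supports stmt-QuantumFields-19200 --as helper`.

References: T. Bałaban, CMP 99 (1985) 389–434 [Balaban1985BackgroundPropagators] (p.392, (3.13)–(3.15) p.393, (3.17) p.393); CMP 98 (1985) 17–51 [Balaban1985Averaging] ((56) p.27, p.28, (82) p.30,
(89)–(92) p.31, (97) p.32); CMP 102 (1985) 277–309 [Balaban1985Variational] ((44) p.285, (47)–(49) p.285).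
-/

set_option autoImplicit false

noncomputable section

open scoped Matrix.Norms.L2Operator

namespace Summit.QuantumFields.YangMills.Theorems.Prop7SymAvgTwSymBridge

open NormedSpace
open Literature.MathematicalPhysics.QuantumFieldTheory.Balaban1983to89
open Literature.MathematicalPhysics.QuantumFieldTheory.Balaban1983to89.T3ContinuumYM3Torus
open T3SectALandauChart (bgUnits)
open B7Prop1Explicit (expUnit val_expUnit)
open MatrixLog (mlog mlog_one)
open B7TransferAnalyticMean (hasFDerivAt_mlog_one)
open Summit.QuantumFields.YangMills.Theorems.Prop7SymAvgGL (descendToGL logChartSym QSym expUnit_zero_mul_bgUnits)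
open Summit.QuantumFields.YangMills.Theorems.Prop7SymAvgTwSym (frameTwS dbarTwS logChartTwS QTwS)
open Summit.QuantumFields.YangMills.Theorems.Prop7SymAvgTwSym (frameTwS_zero dbarTwS_zero)
open Summit.QuantumFields.YangMills.Theorems.Prop7SymAvgTwBridge (logChartSym_apply_rel rel_zero covDeriv_pi_apply QSym_eq_of_hasFDerivAt)

variable (F : T3Family) {n K : ℕ} (h : n ≤ K)

/-! ## §1 The double-bar average factored through the RELATIVE descended perturbation -/

/-- **`U̿^{tw}(A)(c) = w(c₋)⁻¹ · [D̄(e^{A}U₀)(c)·D̄(U₀)(c)⁻¹] · [D̄(U₀)(c)·w(c₊)·D̄(U₀)(c)⁻¹]`** (group algebra): the double-bar average is the RELATIVE descended perturbation — the argument of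
`logChartSym` — conjugated between the inverse frame at `c₋` and the `Ad_{Ū₀(c)}`-rotated frame at `c₊` (print's `R̄_{0,c}\overline{R_{0,c₊}U₁}` in (89)).
[cite: Balaban1985Averaging, (89) p.31, (56) p.27] -/
theorem dbarTwS_eq_conj (U₀ : GaugeField (F.P K) 0 (Matrix.specialUnitaryGroup (Fin 2) ℂ)) (A : PBond (F.P K) 0 → (Matrix (Fin 2) (Fin 2) ℂ)) (c : PBond (F.P n) 0) :
    dbarTwS F n K h U₀ A c
      = (frameTwS F n K h U₀ A c.src)⁻¹
          * (descendToGL F n K h (fun b => expUnit (A b) * bgUnits F K U₀ b) c * (descendToGL F n K h (bgUnits F K U₀) c)⁻¹)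
          * (descendToGL F n K h (bgUnits F K U₀) c * frameTwS F n K h U₀ A c.tgt * (descendToGL F n K h (bgUnits F K U₀) c)⁻¹) := by
  rw [Prop7SymAvgTwSym.dbarTwS_def]; group

/-- The same read in matrices: `logChartTwS U₀ A c = log( w(c₋)⁻¹ · G(A)(c) · (Ū₀(c)·w(c₊)·Ū₀(c)⁻¹) )` with `G(A)(c) := D̄(e^{A}U₀)(c)·D̄(U₀)(c)⁻¹` the argument of `logChartSym`.
[cite: Balaban1985Averaging, (89) p.31; Balaban1985Variational, (44) p.285] -/
theorem logChartTwS_apply_conj (U₀ : GaugeField (F.P K) 0 (Matrix.specialUnitaryGroup (Fin 2) ℂ)) (A : PBond (F.P K) 0 → (Matrix (Fin 2) (Fin 2) ℂ)) (c : PBond (F.P n) 0) :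
    logChartTwS F n K h U₀ A c
      = mlog ((((frameTwS F n K h U₀ A c.src)⁻¹ : (Matrix (Fin 2) (Fin 2) ℂ)ˣ) : (Matrix (Fin 2) (Fin 2) ℂ))
          * (((descendToGL F n K h (fun b => expUnit (A b) * bgUnits F K U₀ b) c : (Matrix (Fin 2) (Fin 2) ℂ)ˣ) : (Matrix (Fin 2) (Fin 2) ℂ)) * (((descendToGL F n K h (bgUnits F K U₀) c)⁻¹ : (Matrix (Fin 2) (Fin 2) ℂ)ˣ) : (Matrix (Fin 2) (Fin 2) ℂ)))
          * (((descendToGL F n K h (bgUnits F K U₀) c : (Matrix (Fin 2) (Fin 2) ℂ)ˣ) : (Matrix (Fin 2) (Fin 2) ℂ)) * ((frameTwS F n K h U₀ A c.tgt : (Matrix (Fin 2) (Fin 2) ℂ)ˣ) : (Matrix (Fin 2) (Fin 2) ℂ))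
              * (((descendToGL F n K h (bgUnits F K U₀) c)⁻¹ : (Matrix (Fin 2) (Fin 2) ℂ)ˣ) : (Matrix (Fin 2) (Fin 2) ℂ)))) := by
  rw [Prop7SymAvgTwSym.logChartTwS_apply, dbarTwS_eq_conj]
  simp only [Units.val_mul]

/-! ## §2 THE BRIDGE `QTwS = QSym − D_{Ū₀} ∘ r` (RULING g26-№1 (2), item (3c)) -/

/-- ★★★ **THE BRIDGE, DERIVATIVE FORM**: let `G(A)(c) = D̄(e^{A}U₀)(c)·D̄(U₀)(c)⁻¹` (the argument of `logChartSym`) be differentiable at `A = 0` with derivative `G′` (so `QSym U₀ = G′`, since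
`log′(1) = id`), and let every frame `A ↦ frameTwS U₀ A y` be differentiable at `0` with derivative `r y` (the linearised accumulated comb frames; `frameTwS U₀ 0 ≡ 1`, p606182).  Then the twisted
log-chart is differentiable at `0` with derivative **`G′ − D_{Ū₀} ∘ r`**: `d[log(w₋⁻¹·G·Ū₀w₊Ū₀⁻¹)]₀ = −r(c₋) + G′ + Ū₀(c)·r(c₊)·Ū₀(c)⁻¹` (product rule at `w = 1`, `G = 1`; `d(w⁻¹) = −dw`
at `w = 1`; `log′(1) = id`). [cite: Balaban1985Averaging, (89) p.31, p.28; Balaban1985BackgroundPropagators, (3.14) p.393; Balaban1985Variational, (44) p.285] -/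
theorem hasFDerivAt_logChartTwS (U₀ : GaugeField (F.P K) 0 (Matrix.specialUnitaryGroup (Fin 2) ℂ))
    {G' : (PBond (F.P K) 0 → (Matrix (Fin 2) (Fin 2) ℂ)) →L[ℂ] (PBond (F.P n) 0 → (Matrix (Fin 2) (Fin 2) ℂ))}
    (hG : HasFDerivAt (fun A : PBond (F.P K) 0 → (Matrix (Fin 2) (Fin 2) ℂ) => fun c : PBond (F.P n) 0 =>
        ((descendToGL F n K h (fun b => expUnit (A b) * bgUnits F K U₀ b) c : (Matrix (Fin 2) (Fin 2) ℂ)ˣ) : (Matrix (Fin 2) (Fin 2) ℂ)) * (((descendToGL F n K h (bgUnits F K U₀) c)⁻¹ : (Matrix (Fin 2) (Fin 2) ℂ)ˣ) : (Matrix (Fin 2) (Fin 2) ℂ))) G' 0)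
    {r : Site (F.P n) 0 → ((PBond (F.P K) 0 → (Matrix (Fin 2) (Fin 2) ℂ)) →L[ℂ] (Matrix (Fin 2) (Fin 2) ℂ))}
    (hr : ∀ y, HasFDerivAt (fun A : PBond (F.P K) 0 → (Matrix (Fin 2) (Fin 2) ℂ) => ((frameTwS F n K h U₀ A y : (Matrix (Fin 2) (Fin 2) ℂ)ˣ) : (Matrix (Fin 2) (Fin 2) ℂ))) (r y) 0) :
    HasFDerivAt (logChartTwS F n K h U₀)
      (G' - ContinuousLinearMap.pi fun c : PBond (F.P n) 0 =>
        r c.src - (ContinuousLinearMap.mulLeftRight ℂ (Matrix (Fin 2) (Fin 2) ℂ) ((descendToGL F n K h (bgUnits F K U₀) c : (Matrix (Fin 2) (Fin 2) ℂ)ˣ) : (Matrix (Fin 2) (Fin 2) ℂ))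
          (((descendToGL F n K h (bgUnits F K U₀) c)⁻¹ : (Matrix (Fin 2) (Fin 2) ℂ)ˣ) : (Matrix (Fin 2) (Fin 2) ℂ))).comp (r c.tgt)) 0 := by
  -- coordinatewise
  apply hasFDerivAt_pi''
  intro c
  -- letters at the bond `c`
  set P₀ : (Matrix (Fin 2) (Fin 2) ℂ) := ((descendToGL F n K h (bgUnits F K U₀) c : (Matrix (Fin 2) (Fin 2) ℂ)ˣ) : (Matrix (Fin 2) (Fin 2) ℂ)) with hP₀
  set P₀i : (Matrix (Fin 2) (Fin 2) ℂ) := (((descendToGL F n K h (bgUnits F K U₀) c)⁻¹ : (Matrix (Fin 2) (Fin 2) ℂ)ˣ) : (Matrix (Fin 2) (Fin 2) ℂ)) with hP₀i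
  have hPP : P₀ * P₀i = 1 := by rw [hP₀, hP₀i, ← Units.val_mul, mul_inv_cancel, Units.val_one]
  -- the three factors as functions of `A`
  set Gc : (PBond (F.P K) 0 → (Matrix (Fin 2) (Fin 2) ℂ)) → (Matrix (Fin 2) (Fin 2) ℂ) := fun A =>
    ((descendToGL F n K h (fun b => expUnit (A b) * bgUnits F K U₀ b) c : (Matrix (Fin 2) (Fin 2) ℂ)ˣ) : (Matrix (Fin 2) (Fin 2) ℂ)) * P₀i with hGc
  set Wm : (PBond (F.P K) 0 → (Matrix (Fin 2) (Fin 2) ℂ)) → (Matrix (Fin 2) (Fin 2) ℂ) := fun A => ((frameTwS F n K h U₀ A c.src : (Matrix (Fin 2) (Fin 2) ℂ)ˣ) : (Matrix (Fin 2) (Fin 2) ℂ)) with hWm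
  set Wp : (PBond (F.P K) 0 → (Matrix (Fin 2) (Fin 2) ℂ)) → (Matrix (Fin 2) (Fin 2) ℂ) := fun A => ((frameTwS F n K h U₀ A c.tgt : (Matrix (Fin 2) (Fin 2) ℂ)ˣ) : (Matrix (Fin 2) (Fin 2) ℂ)) with hWp
  set Wmi : (PBond (F.P K) 0 → (Matrix (Fin 2) (Fin 2) ℂ)) → (Matrix (Fin 2) (Fin 2) ℂ) := fun A => (((frameTwS F n K h U₀ A c.src)⁻¹ : (Matrix (Fin 2) (Fin 2) ℂ)ˣ) : (Matrix (Fin 2) (Fin 2) ℂ)) with hWmi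
  -- their derivatives at 0
  have hGc' : HasFDerivAt Gc ((ContinuousLinearMap.proj c).comp G') 0 := by
    have := (hasFDerivAt_pi'.1 hG) c
    exact this
  have hGc0 : Gc 0 = 1 := by rw [hGc]; exact rel_zero F h U₀ c
  have hWm' : HasFDerivAt Wm (r c.src) 0 := hr c.src
  have hWp' : HasFDerivAt Wp (r c.tgt) 0 := hr c.tgt
  have hWm0 : Wm 0 = 1 := by rw [hWm]; simp only [frameTwS_zero, Units.val_one]
  have hWp0 : Wp 0 = 1 := by rw [hWp]; simp only [frameTwS_zero, Units.val_one]
  -- the inverse frame: `Ring.inverse ∘ Wm`, derivative `−r(c₋)` at `Wm 0 = 1`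
  have hWmi_eq : Wmi = fun A => Ring.inverse (Wm A) := by
    funext A; rw [hWmi, hWm]; exact (Ring.inverse_unit _).symm
  have hinv1 : HasFDerivAt (Ring.inverse : (Matrix (Fin 2) (Fin 2) ℂ) → (Matrix (Fin 2) (Fin 2) ℂ)) (-ContinuousLinearMap.mulLeftRight ℂ (Matrix (Fin 2) (Fin 2) ℂ) (1 : (Matrix (Fin 2) (Fin 2) ℂ)) (1 : (Matrix (Fin 2) (Fin 2) ℂ))) (Wm 0) := by
    rw [hWm0]
    have := hasFDerivAt_ringInverse (𝕜 := ℂ) (1 : (Matrix (Fin 2) (Fin 2) ℂ)ˣ)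
    simpa using this
  have hWmi' : HasFDerivAt Wmi ((-ContinuousLinearMap.mulLeftRight ℂ (Matrix (Fin 2) (Fin 2) ℂ) (1 : (Matrix (Fin 2) (Fin 2) ℂ)) (1 : (Matrix (Fin 2) (Fin 2) ℂ))).comp (r c.src)) 0 := by
    rw [hWmi_eq]; exact hinv1.comp 0 hWm'
  have hWmi0 : Wmi 0 = 1 := by rw [hWmi]; simp only [frameTwS_zero, inv_one, Units.val_one]
  -- the rotated frame `P₀ · Wp · P₀⁻¹`
  set Rot : (PBond (F.P K) 0 → (Matrix (Fin 2) (Fin 2) ℂ)) → (Matrix (Fin 2) (Fin 2) ℂ) := fun A => P₀ * Wp A * P₀i with hRot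
  have hRot' := (hWp'.const_mul P₀).mul_const' P₀i
  have hRot0 : Rot 0 = 1 := by rw [hRot]; simp only [hWp0, mul_one, hPP]
  -- the product `Wmi · Gc · Rot` and `mlog` of it
  have hprod := (hWmi'.mul' hGc').mul' hRot'
  have hval0 : Wmi 0 * Gc 0 * Rot 0 = 1 := by rw [hWmi0, hGc0, hRot0, one_mul, one_mul]
  have hmlog : HasFDerivAt (mlog : (Matrix (Fin 2) (Fin 2) ℂ) → (Matrix (Fin 2) (Fin 2) ℂ)) (1 : (Matrix (Fin 2) (Fin 2) ℂ) →L[ℂ] (Matrix (Fin 2) (Fin 2) ℂ)) (Wmi 0 * Gc 0 * (fun A => P₀ * Wp A * P₀i) 0) := by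
    rw [show (fun A => P₀ * Wp A * P₀i) 0 = Rot 0 from rfl, hval0]; exact hasFDerivAt_mlog_one
  have hcomp := hmlog.comp 0 hprod
  -- identify the function and the derivative
  have hfun : (fun A => logChartTwS F n K h U₀ A c) = fun A => mlog (Wmi A * Gc A * (P₀ * Wp A * P₀i)) := by
    funext A
    rw [logChartTwS_apply_conj]
  rw [hfun]
  rw [ContinuousLinearMap.one_def, ContinuousLinearMap.id_comp] at hcomp
  refine hcomp.congr_fderiv (ContinuousLinearMap.ext fun A => ?_)
  have hGc0' : Gc 0 = 1 := hGc0
  simp only [ContinuousLinearMap.comp_apply, add_apply, sub_apply, neg_apply, smul_apply, Pi.mul_apply, Pi.sub_apply,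
    op_smul_eq_mul, smul_eq_mul, ContinuousLinearMap.proj_apply, ContinuousLinearMap.pi_apply, ContinuousLinearMap.mulLeftRight_apply,
    hWmi0, hGc0', hWp0, one_mul, mul_one, hPP, one_smul]
  rw [← hP₀i, ← hP₀]
  abel

/-- ★★★ **THE BRIDGE `QTwS = QSym − D_{Ū₀} ∘ r`** (RULING g26-№1 (2): the computational core `QSym` is consumed through this identity): under the hypotheses of `hasFDerivAt_logChartTwS`,
print's averaging operator `Q(U₀) = QTwS U₀` is the symmetric linearised average `QSym U₀` MINUS the coarse covariant derivative of the linearised frames `r`.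
[cite: Balaban1985BackgroundPropagators, (3.14)–(3.15) p.393; Balaban1985Averaging, (89) p.31, p.28; Balaban1985Variational, (44) p.285] -/
theorem QTwS_eq_QSym_sub (U₀ : GaugeField (F.P K) 0 (Matrix.specialUnitaryGroup (Fin 2) ℂ))
    {G' : (PBond (F.P K) 0 → (Matrix (Fin 2) (Fin 2) ℂ)) →L[ℂ] (PBond (F.P n) 0 → (Matrix (Fin 2) (Fin 2) ℂ))}
    (hG : HasFDerivAt (fun A : PBond (F.P K) 0 → (Matrix (Fin 2) (Fin 2) ℂ) => fun c : PBond (F.P n) 0 =>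
        ((descendToGL F n K h (fun b => expUnit (A b) * bgUnits F K U₀ b) c : (Matrix (Fin 2) (Fin 2) ℂ)ˣ) : (Matrix (Fin 2) (Fin 2) ℂ)) * (((descendToGL F n K h (bgUnits F K U₀) c)⁻¹ : (Matrix (Fin 2) (Fin 2) ℂ)ˣ) : (Matrix (Fin 2) (Fin 2) ℂ))) G' 0)
    {r : Site (F.P n) 0 → ((PBond (F.P K) 0 → (Matrix (Fin 2) (Fin 2) ℂ)) →L[ℂ] (Matrix (Fin 2) (Fin 2) ℂ))}
    (hr : ∀ y, HasFDerivAt (fun A : PBond (F.P K) 0 → (Matrix (Fin 2) (Fin 2) ℂ) => ((frameTwS F n K h U₀ A y : (Matrix (Fin 2) (Fin 2) ℂ)ˣ) : (Matrix (Fin 2) (Fin 2) ℂ))) (r y) 0) :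
    QTwS F n K h U₀ = QSym F n K h U₀ - ContinuousLinearMap.pi fun c : PBond (F.P n) 0 =>
        r c.src - (ContinuousLinearMap.mulLeftRight ℂ (Matrix (Fin 2) (Fin 2) ℂ) ((descendToGL F n K h (bgUnits F K U₀) c : (Matrix (Fin 2) (Fin 2) ℂ)ˣ) : (Matrix (Fin 2) (Fin 2) ℂ))
          (((descendToGL F n K h (bgUnits F K U₀) c)⁻¹ : (Matrix (Fin 2) (Fin 2) ℂ)ˣ) : (Matrix (Fin 2) (Fin 2) ℂ))).comp (r c.tgt) := by
  -- `QSym = G′`: `logChartSym = mlog ∘ G` coordinatewise, `G(0) = 1`, `log′(1) = id`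
  have hS : HasFDerivAt (logChartSym F n K h U₀) G' 0 := by
    apply hasFDerivAt_pi''
    intro c
    have hGc : HasFDerivAt (fun A : PBond (F.P K) 0 → (Matrix (Fin 2) (Fin 2) ℂ) =>
        ((descendToGL F n K h (fun b => expUnit (A b) * bgUnits F K U₀ b) c : (Matrix (Fin 2) (Fin 2) ℂ)ˣ) : (Matrix (Fin 2) (Fin 2) ℂ)) * (((descendToGL F n K h (bgUnits F K U₀) c)⁻¹ : (Matrix (Fin 2) (Fin 2) ℂ)ˣ) : (Matrix (Fin 2) (Fin 2) ℂ)))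
        ((ContinuousLinearMap.proj c).comp G') 0 := (hasFDerivAt_pi'.1 hG) c
    have hmlog : HasFDerivAt (mlog : (Matrix (Fin 2) (Fin 2) ℂ) → (Matrix (Fin 2) (Fin 2) ℂ)) (1 : (Matrix (Fin 2) (Fin 2) ℂ) →L[ℂ] (Matrix (Fin 2) (Fin 2) ℂ))
        (((descendToGL F n K h (fun b => expUnit ((0 : PBond (F.P K) 0 → (Matrix (Fin 2) (Fin 2) ℂ)) b) * bgUnits F K U₀ b) c : (Matrix (Fin 2) (Fin 2) ℂ)ˣ) : (Matrix (Fin 2) (Fin 2) ℂ))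
          * (((descendToGL F n K h (bgUnits F K U₀) c)⁻¹ : (Matrix (Fin 2) (Fin 2) ℂ)ˣ) : (Matrix (Fin 2) (Fin 2) ℂ))) := by
      rw [rel_zero]; exact hasFDerivAt_mlog_one
    have hcomp := hmlog.comp 0 hGc
    rw [ContinuousLinearMap.one_def, ContinuousLinearMap.id_comp] at hcomp
    exact hcomp
  rw [Prop7SymAvgTwSym.QTwS_def, Summit.QuantumFields.YangMills.Theorems.Prop7SymAvgGL.QSym, (hasFDerivAt_logChartTwS F h U₀ hG hr).fderiv, hS.fderiv]

/-- **THE BRIDGE, APPLIED**: `QTwS U₀ A c = QSym U₀ A c − (r(c₋)A − Ū₀(c)·r(c₊)A·Ū₀(c)⁻¹)`. [cite: Balaban1985BackgroundPropagators, (3.14) p.393; Balaban1985Averaging, p.28] -/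
theorem QTwS_apply_eq (U₀ : GaugeField (F.P K) 0 (Matrix.specialUnitaryGroup (Fin 2) ℂ))
    {G' : (PBond (F.P K) 0 → (Matrix (Fin 2) (Fin 2) ℂ)) →L[ℂ] (PBond (F.P n) 0 → (Matrix (Fin 2) (Fin 2) ℂ))}
    (hG : HasFDerivAt (fun A : PBond (F.P K) 0 → (Matrix (Fin 2) (Fin 2) ℂ) => fun c : PBond (F.P n) 0 =>
        ((descendToGL F n K h (fun b => expUnit (A b) * bgUnits F K U₀ b) c : (Matrix (Fin 2) (Fin 2) ℂ)ˣ) : (Matrix (Fin 2) (Fin 2) ℂ)) * (((descendToGL F n K h (bgUnits F K U₀) c)⁻¹ : (Matrix (Fin 2) (Fin 2) ℂ)ˣ) : (Matrix (Fin 2) (Fin 2) ℂ))) G' 0)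
    {r : Site (F.P n) 0 → ((PBond (F.P K) 0 → (Matrix (Fin 2) (Fin 2) ℂ)) →L[ℂ] (Matrix (Fin 2) (Fin 2) ℂ))}
    (hr : ∀ y, HasFDerivAt (fun A : PBond (F.P K) 0 → (Matrix (Fin 2) (Fin 2) ℂ) => ((frameTwS F n K h U₀ A y : (Matrix (Fin 2) (Fin 2) ℂ)ˣ) : (Matrix (Fin 2) (Fin 2) ℂ))) (r y) 0)
    (A : PBond (F.P K) 0 → (Matrix (Fin 2) (Fin 2) ℂ)) (c : PBond (F.P n) 0) :
    QTwS F n K h U₀ A c = QSym F n K h U₀ A c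
      - (r c.src A - ((descendToGL F n K h (bgUnits F K U₀) c : (Matrix (Fin 2) (Fin 2) ℂ)ˣ) : (Matrix (Fin 2) (Fin 2) ℂ)) * r c.tgt A * (((descendToGL F n K h (bgUnits F K U₀) c)⁻¹ : (Matrix (Fin 2) (Fin 2) ℂ)ˣ) : (Matrix (Fin 2) (Fin 2) ℂ))) := by
  rw [QTwS_eq_QSym_sub F h U₀ hG hr, sub_apply, Pi.sub_apply, covDeriv_pi_apply]

end Summit.QuantumFields.YangMills.Theorems.Prop7SymAvgTwSymBridge

end
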